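import Mathlib.Geometry.Manifold.ContMDiffMFDeriv
import Literature.Geometry.Manifold.VectorFieldDualOneForm
import Literature.Geometry.Manifold.CircleAverageOneForm
import Literature.Geometry.Symplectic.CircleInvariantForms
import HarnessLib

/-!
# A connection form for a free smooth circle action

Sixth proofs companion of `OrigamiUnfolding.lean` (fact seat of
`Literature.Geometry.Symplectic.exists_symplecticCutPieces_of_isOrigamiForm`), the first input of
step (S1), the Moser model `φ^*ω = p^*i^*ω + d(t² p^*α)` near the fold (Cannas da Silva–Guillemin–
Pires, *Symplectic Origami*, proof of Prop. 2.8, quoting Cannas da Silva–Guillemin–Woodward 2000,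
Thm. 1: "`α` is an `S¹`-connection form for the null fibration `Z → B`").  For a free smooth
action of Mathlib's `Circle` on a Hausdorff `σ`-compact manifold `N` modelled on `ℝᵐ`
(`[MulAction Circle N]`, fundamental vector field `X = circleFundVec`):

* `contMDiff_circleFundVec` — `X` is a smooth vector field (tangent map of the action map along
  the smooth section `n ↦ ((0, n), (1, 0))` of `T(ℝ × N)`); `circleFundVec_ne_zero` — it does
  not vanish (`Literature.Geometry.Manifold.mfderiv_circleOrbit_apply_one_ne_zero`);
* `mextDeriv_apply_circleFundVec` — an invariant smooth `1`-form with `α(X) ≡ 1` has horizontal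
  curvature, `dα(X, ·) = 0`, proved WITHOUT Cartan's formula: along the action map
  `Φ(s, n) = e^{is} • n`, `Φ^*α = ds + π_N^*α` (`pullback_expSmul_apply`), so
  `Φ^*dα = π_N^*dα` by naturality of `d`, and at `(0, n)` this is `dα(X, w) = dα(0, w) = 0`;
* **`exists_circleConnectionForm`** — there is a smooth `1`-form `α` on `N` which is invariant,
  `(a • ·)^* α = α`, normalised, `α(X) ≡ 1`, and has horizontal curvature: average
  (`Literature.Geometry.Manifold.exists_circleAverage_oneForm`) a smooth `1`-form `α₀` with
  `α₀(X) ≡ 1` (`Literature.Geometry.Manifold.exists_isSmoothForm_apply_eq_one`).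

Everything here is proved; no definitions, no facts.

## References

* A. Cannas da Silva, V. Guillemin, A. R. Pires, *Symplectic Origami*, IMRN 2011 =
  arXiv:0909.4065, proof of Prop. 2.8. [CannasdasilvaGuilleminPires2010]
* A. Cannas da Silva, V. Guillemin, C. Woodward, *On the unfolding of folded symplectic
  structures*, Math. Res. Lett. 7 (2000), Thm. 1. [CannasGuilleminWoodward2000]
* S. Kobayashi, K. Nomizu, *Foundations of Differential Geometry I* (1963), Ch. II, Thm. 2.1
  (existence of connections in principal bundles).
-/

noncomputable section

open scoped Manifold ContDiff Topology Real
open Set Function Filter Bundle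
open Literature.Geometry.Kaehler Literature.Geometry.Manifold

namespace Literature.Geometry.Symplectic

variable {m : ℕ} {N : Type*} [TopologicalSpace N] [ChartedSpace (EuclideanSpace ℝ (Fin m)) N]
  [IsManifold (𝓡 m) ∞ N] [MulAction Circle N]

/-- **The fundamental vector field of a smooth circle action is smooth**: its fibre coordinates
in the trivialisation of `TN` at `n₀` are those of the smooth map `n ↦ dΘ_{(0,n)}(1, 0)`
(tangent map of the action map `Θ(t, n) = e^{it} • n` along a smooth section), read through the
same tangent coordinate change. [folklore] -/
theorem contMDiff_circleFundVec
    (hθ : ContMDiff ((𝓡 1).prod (𝓡 m)) (𝓡 m) ∞ (fun x : Circle × N => x.1 • x.2)) :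
    ContMDiff (𝓡 m) (𝓡 m).tangent ∞
      (fun n : N => (⟨n, circleFundVec n⟩ : TangentBundle (𝓡 m) N)) := by
  set Θ : ℝ × N → N := fun p => Circle.exp p.1 • p.2 with hΘ
  have hΘs : ContMDiff (𝓘(ℝ, ℝ).prod (𝓡 m)) (𝓡 m) ∞ Θ := contMDiff_expSmul hθ
  have hΘ0 : ∀ n, Θ (0, n) = n := fun n => by
    show Circle.exp 0 • n = n
    rw [Circle.exp_zero, one_smul]
  -- the smooth section `n ↦ ((0, n), (1, 0))` of `T(ℝ × N)` and the tangent map of `Θ` along it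
  have hsec : ContMDiff (𝓡 m) (𝓘(ℝ, ℝ).prod (𝓡 m)).tangent ∞ (fun n : N =>
      (⟨((0 : ℝ), n), (((1 : ℝ), (0 : EuclideanSpace ℝ (Fin m))) : ℝ × EuclideanSpace ℝ (Fin m))⟩ :
        TangentBundle (𝓘(ℝ, ℝ).prod (𝓡 m)) (ℝ × N))) := by
    have hτ : ContMDiff 𝓘(ℝ, ℝ) 𝓘(ℝ, ℝ).tangent ∞
        (fun t : ℝ => (⟨t, (1 : ℝ)⟩ : TangentBundle 𝓘(ℝ, ℝ) ℝ)) :=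
      contMDiff_vectorSpace_iff_contDiff.2 contDiff_const
    have hzero : ContMDiff (𝓡 m) (𝓡 m).tangent ∞
        (fun n : N => (⟨n, 0⟩ : TangentBundle (𝓡 m) N)) :=
      contMDiff_zeroSection ℝ (TangentSpace (𝓡 m) : N → Type _)
    have hpair : ContMDiff (𝓡 m) (𝓘(ℝ, ℝ).tangent.prod (𝓡 m).tangent) ∞
        (fun n : N => ((⟨(0 : ℝ), (1 : ℝ)⟩ : TangentBundle 𝓘(ℝ, ℝ) ℝ),
          (⟨n, 0⟩ : TangentBundle (𝓡 m) N))) :=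
      (hτ.comp contMDiff_const).prodMk hzero
    have h := (contMDiff_equivTangentBundleProd_symm (I := 𝓘(ℝ, ℝ)) (M := ℝ) (I' := 𝓡 m)
      (M' := N) (n := ∞)).comp hpair
    exact h.congr fun n => rfl
  have htan : ContMDiff (𝓡 m) (𝓡 m).tangent ∞ (fun n : N =>
      tangentMap (𝓘(ℝ, ℝ).prod (𝓡 m)) (𝓡 m) Θ
        ⟨((0 : ℝ), n),
          (((1 : ℝ), (0 : EuclideanSpace ℝ (Fin m))) : ℝ × EuclideanSpace ℝ (Fin m))⟩) :=
    (hΘs.contMDiff_tangentMap le_rfl).comp hsec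
  -- the orbit velocity is `dΘ_{(0,n)}(1, 0)`
  have hval : ∀ n : N, circleFundVec n = mfderiv (𝓘(ℝ, ℝ).prod (𝓡 m)) (𝓡 m) Θ (0, n)
      (((1 : ℝ), (0 : EuclideanSpace ℝ (Fin m))) : ℝ × EuclideanSpace ℝ (Fin m)) := by
    intro n
    have hι : HasMFDerivAt 𝓘(ℝ, ℝ) (𝓘(ℝ, ℝ).prod (𝓡 m)) (fun t : ℝ => ((t, n) : ℝ × N)) 0
        ((ContinuousLinearMap.id ℝ ℝ).prod (0 : ℝ →L[ℝ] EuclideanSpace ℝ (Fin m))) :=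
      (hasMFDerivAt_id (0 : ℝ)).prodMk (hasMFDerivAt_const n (0 : ℝ))
    have hd : MDifferentiableAt (𝓘(ℝ, ℝ).prod (𝓡 m)) (𝓡 m) Θ (0, n) :=
      hΘs.mdifferentiableAt (by norm_num)
    have hcomp := hd.hasMFDerivAt.comp 0 hι
    have heq : Θ ∘ (fun t : ℝ => ((t, n) : ℝ × N)) = fun t : ℝ => Circle.exp t • n := rfl
    rw [heq] at hcomp
    exact congrArg (fun L => L (1 : ℝ)) hcomp.mfderiv
  -- compare fibre coordinates in the trivialisation at `n₀`
  intro n₀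
  have h2 := (contMDiffAt_totalSpace.1 (htan n₀)).2
  simp only [TangentBundle.trivializationAt_apply, tangentMap] at h2
  rw [hΘ0 n₀] at h2
  rw [(trivializationAt (EuclideanSpace ℝ (Fin m)) (TangentSpace (𝓡 m) : N → Type _) n₀)
    |>.contMDiffAt_section_iff (FiberBundle.mem_baseSet_trivializationAt' n₀)]
  simp only [TangentBundle.trivializationAt_apply]
  refine h2.congr_of_eventuallyEq (Filter.Eventually.of_forall fun n => ?_)
  have key : ∀ (z : N) (_ : z = n) (w : EuclideanSpace ℝ (Fin m)),
      fderivWithin ℝ ((chartAt (EuclideanSpace ℝ (Fin m)) n₀).extend (𝓡 m) ∘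
          ((chartAt (EuclideanSpace ℝ (Fin m)) z).extend (𝓡 m)).symm) (range (𝓡 m))
          ((chartAt (EuclideanSpace ℝ (Fin m)) z).extend (𝓡 m) z) w =
        fderivWithin ℝ ((chartAt (EuclideanSpace ℝ (Fin m)) n₀).extend (𝓡 m) ∘
          ((chartAt (EuclideanSpace ℝ (Fin m)) n).extend (𝓡 m)).symm) (range (𝓡 m))
          ((chartAt (EuclideanSpace ℝ (Fin m)) n).extend (𝓡 m) n) w := by
    intro z hz w
    subst hz
    rfl
  beta_reduce
  refine (congrArg _ (hval n)).trans ?_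
  exact (key (Θ (0, n)) (hΘ0 n) _).symm

omit [IsManifold (𝓡 m) ∞ N] in
/-- **The fundamental vector field of a free smooth circle action does not vanish.**
[cite: LeeSmoothManifolds2013, Prop. 21.7] -/
theorem circleFundVec_ne_zero [IsManifold (𝓡 m) ∞ N]
    (hθ : ContMDiff ((𝓡 1).prod (𝓡 m)) (𝓡 m) ∞ (fun x : Circle × N => x.1 • x.2))
    (hfree : ∀ (a : Circle) (n : N), a • n = n → a = 1) (n : N) :
    circleFundVec (m := m) n ≠ 0 :=
  mfderiv_circleOrbit_apply_one_ne_zero (θ := fun (a : Circle) (x : N) => a • x) hθ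
    (fun x => one_smul _ x) (fun a b x => mul_smul a b x) hfree n

/-! ### The curvature of an invariant normalised form is horizontal: `ι_X dα = 0` -/

omit [IsManifold (𝓡 m) ∞ N] in
/-- `dΦ_{(s,n)}(1, 0) = X(e^{is} • n)` for the action map `Φ(s, n) = e^{is} • n` (the curve
`t ↦ Φ(t, n)` is the orbit). [folklore] -/
theorem mfderiv_expSmul_inl
    (hθ : ContMDiff ((𝓡 1).prod (𝓡 m)) (𝓡 m) ∞ (fun x : Circle × N => x.1 • x.2))
    (s : ℝ) (n : N) :
    mfderiv (𝓘(ℝ, ℝ).prod (𝓡 m)) (𝓡 m) (fun p : ℝ × N => Circle.exp p.1 • p.2) (s, n)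
        (((1 : ℝ), (0 : EuclideanSpace ℝ (Fin m))) : ℝ × EuclideanSpace ℝ (Fin m)) =
      circleFundVec (Circle.exp s • n) := by
  have hι : HasMFDerivAt 𝓘(ℝ, ℝ) (𝓘(ℝ, ℝ).prod (𝓡 m)) (fun t : ℝ => ((t, n) : ℝ × N)) s
      ((ContinuousLinearMap.id ℝ ℝ).prod (0 : ℝ →L[ℝ] EuclideanSpace ℝ (Fin m))) :=
    (hasMFDerivAt_id s).prodMk (hasMFDerivAt_const n s)
  have hd : MDifferentiableAt (𝓘(ℝ, ℝ).prod (𝓡 m)) (𝓡 m)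
      (fun p : ℝ × N => Circle.exp p.1 • p.2) (s, n) :=
    (contMDiff_expSmul hθ).mdifferentiableAt (by norm_num)
  have hcomp := hd.hasMFDerivAt.comp s hι
  have heq : ((fun p : ℝ × N => Circle.exp p.1 • p.2) ∘ fun t : ℝ => ((t, n) : ℝ × N)) =
      fun t : ℝ => Circle.exp t • n := rfl
  rw [heq] at hcomp
  rw [← mfderiv_circleOrbit_apply_one hθ n s]
  exact (congrArg (fun L => L (1 : ℝ)) hcomp.mfderiv).symm

omit [IsManifold (𝓡 m) ∞ N] in
/-- **The pull-back of an invariant normalised `1`-form along the action map is `ds + π_N^*α`**: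
`(Φ^*α)_{(s,n)}(σ, w) = σ + α_n(w)` (`dΦ(σ, w) = σ X + d(e^{is}·) w`, `α(X) = 1`, invariance).
[folklore] -/
theorem pullback_expSmul_apply
    (hθ : ContMDiff ((𝓡 1).prod (𝓡 m)) (𝓡 m) ∞ (fun x : Circle × N => x.1 • x.2))
    {α : MForm (𝓡 m) N ℝ 1}
    (hinv : ∀ (a : Circle) (n : N) (v : Fin 1 → TangentSpace (𝓡 m) n),
      α (a • n) (fun i => mfderiv (𝓡 m) (𝓡 m) (fun x : N => a • x) n (v i)) = α n v)
    (hX : ∀ n : N, α n ![circleFundVec n] = 1) (s : ℝ) (n : N) (σ : ℝ)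
    (w : EuclideanSpace ℝ (Fin m)) :
    (α.pullback (𝓘(ℝ, ℝ).prod (𝓡 m)) (fun p : ℝ × N => Circle.exp p.1 • p.2)) (s, n)
      ![((σ, w) : ℝ × EuclideanSpace ℝ (Fin m))] = σ + α n ![w] := by
  set Φ : ℝ × N → N := fun p => Circle.exp p.1 • p.2 with hΦ
  rw [MForm.pullback_apply]
  have hvec : (fun i : Fin 1 => mfderiv (𝓘(ℝ, ℝ).prod (𝓡 m)) (𝓡 m) Φ (s, n)
      (![((σ, w) : ℝ × EuclideanSpace ℝ (Fin m))] i)) =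
      ![mfderiv (𝓘(ℝ, ℝ).prod (𝓡 m)) (𝓡 m) Φ (s, n) ((σ, w) : ℝ × EuclideanSpace ℝ (Fin m))] := by
    funext i
    fin_cases i
    rfl
  refine (congrArg (α (Φ (s, n))) hvec).trans ?_
  -- split the vector and use linearity of `dΦ` and of `α`
  set A := mfderiv (𝓘(ℝ, ℝ).prod (𝓡 m)) (𝓡 m) Φ (s, n)
    (((1 : ℝ), (0 : EuclideanSpace ℝ (Fin m))) : ℝ × EuclideanSpace ℝ (Fin m)) with hA
  set B := mfderiv (𝓘(ℝ, ℝ).prod (𝓡 m)) (𝓡 m) Φ (s, n)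
    (((0 : ℝ), w) : ℝ × EuclideanSpace ℝ (Fin m)) with hB
  have hsplit : ((σ, w) : ℝ × EuclideanSpace ℝ (Fin m)) =
      σ • (((1 : ℝ), (0 : EuclideanSpace ℝ (Fin m))) : ℝ × EuclideanSpace ℝ (Fin m)) +
        (((0 : ℝ), w) : ℝ × EuclideanSpace ℝ (Fin m)) := by
    ext <;> simp
  have hlin : mfderiv (𝓘(ℝ, ℝ).prod (𝓡 m)) (𝓡 m) Φ (s, n) ((σ, w) : ℝ × EuclideanSpace ℝ (Fin m)) =
      σ • A + B :=
    (congrArg (mfderiv (𝓘(ℝ, ℝ).prod (𝓡 m)) (𝓡 m) Φ (s, n)) hsplit).trans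
      (((mfderiv (𝓘(ℝ, ℝ).prod (𝓡 m)) (𝓡 m) Φ (s, n)).map_add _ _).trans
        (congrArg (fun z => z + B) ((mfderiv (𝓘(ℝ, ℝ).prod (𝓡 m)) (𝓡 m) Φ (s, n)).map_smul σ _)))
  have e1 : α (Φ (s, n)) ![σ • A + B] = σ * α (Φ (s, n)) ![A] + α (Φ (s, n)) ![B] := by
    rw [(α (Φ (s, n))).vecCons_add ![] _ _, (α (Φ (s, n))).vecCons_smul ![] σ _, smul_eq_mul]
  have e2 : α (Φ (s, n)) ![A] = 1 :=
    (congrArg (fun z => α (Φ (s, n)) ![z]) (mfderiv_expSmul_inl hθ s n)).trans (hX _)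
  have hw : (fun i : Fin 1 => mfderiv (𝓡 m) (𝓡 m) (fun x : N => Circle.exp s • x) n (![w] i)) =
      ![mfderiv (𝓡 m) (𝓡 m) (fun x : N => Circle.exp s • x) n w] := by
    funext i
    fin_cases i
    rfl
  have e3 : α (Φ (s, n)) ![B] = α n ![w] :=
    ((congrArg (fun z => α (Φ (s, n)) ![z]) (mfderiv_smul_eq_mfderiv_expSmul hθ s n w)).symm.trans
      (congrArg (α (Circle.exp s • n)) hw).symm).trans (hinv (Circle.exp s) n ![w])
  refine (congrArg (fun z => α (Φ (s, n)) ![z]) hlin).trans ?_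
  rw [e1, e2, e3, mul_one]

/-- **The curvature of an invariant connection form is horizontal**: for a smooth `1`-form `α`
with `(a • ·)^* α = α` and `α(X) ≡ 1`, `dα(X, ·) = 0`.  WITHOUT Cartan's formula: along the action
map `Φ(s, n) = e^{is} • n` one has `Φ^*α = ds + π_N^*α` (`pullback_expSmul_apply`), so by
naturality `Φ^*dα = d(Φ^*α) = π_N^* dα`; evaluated at `(0, n)` on `((1,0), (0,w))` this reads
`dα_n(X_n, w) = dα_n(0, w) = 0`. [cite: CannasGuilleminWoodward2000, proof of Thm. 1] -/
theorem mextDeriv_apply_circleFundVec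
    (hθ : ContMDiff ((𝓡 1).prod (𝓡 m)) (𝓡 m) ∞ (fun x : Circle × N => x.1 • x.2))
    {α : MForm (𝓡 m) N ℝ 1} (hα : IsSmoothForm α)
    (hinv : ∀ (a : Circle) (n : N) (v : Fin 1 → TangentSpace (𝓡 m) n),
      α (a • n) (fun i => mfderiv (𝓡 m) (𝓡 m) (fun x : N => a • x) n (v i)) = α n v)
    (hX : ∀ n : N, α n ![circleFundVec n] = 1) (n : N) (w : TangentSpace (𝓡 m) n) :
    mextDeriv α n ![circleFundVec n, w] = 0 := by
  set Φ : ℝ × N → N := fun p => Circle.exp p.1 • p.2 with hΦ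
  set β : MForm (𝓘(ℝ, ℝ).prod (𝓡 m)) (ℝ × N) ℝ 1 := α.pullback (𝓘(ℝ, ℝ).prod (𝓡 m)) Φ with hβ
  set τ : MForm 𝓘(ℝ, ℝ) ℝ ℝ 1 := fun _ =>
    ContinuousAlternatingMap.ofSubsingleton ℝ ℝ ℝ (0 : Fin 1) (ContinuousLinearMap.id ℝ ℝ) with hτ
  set γ₁ : MForm (𝓘(ℝ, ℝ).prod (𝓡 m)) (ℝ × N) ℝ 1 :=
    τ.pullback (I' := 𝓘(ℝ, ℝ)) (𝓘(ℝ, ℝ).prod (𝓡 m)) (Prod.fst : ℝ × N → ℝ) with hγ₁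
  set γ₂ : MForm (𝓘(ℝ, ℝ).prod (𝓡 m)) (ℝ × N) ℝ 1 :=
    α.pullback (𝓘(ℝ, ℝ).prod (𝓡 m)) (Prod.snd : ℝ × N → N) with hγ₂
  have hαs := (isSmoothForm_iff_smoothAt (α := α)).1 hα
  have hτs : ∀ s : ℝ, τ.SmoothAt s := fun s =>
    MForm.smoothAt_self_of_contDiffAt contDiffAt_const
  -- values of `γ₁ + γ₂`
  have hγval : ∀ (s : ℝ) (n : N) (σ : ℝ) (w : EuclideanSpace ℝ (Fin m)),
      (γ₁ + γ₂) (s, n) ![((σ, w) : ℝ × EuclideanSpace ℝ (Fin m))] = σ + α n ![w] := by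
    intro s n σ w
    have h1 : (fun i : Fin 1 => mfderiv (𝓘(ℝ, ℝ).prod (𝓡 m)) 𝓘(ℝ, ℝ) (Prod.fst : ℝ × N → ℝ) (s, n)
        (![((σ, w) : ℝ × EuclideanSpace ℝ (Fin m))] i)) = ![σ] := by
      funext i
      fin_cases i
      show mfderiv (𝓘(ℝ, ℝ).prod (𝓡 m)) 𝓘(ℝ, ℝ) (Prod.fst : ℝ × N → ℝ) (s, n)
        ((σ, w) : ℝ × EuclideanSpace ℝ (Fin m)) = σ
      rw [mfderiv_fst]
      rfl
    have h2 : (fun i : Fin 1 => mfderiv (𝓘(ℝ, ℝ).prod (𝓡 m)) (𝓡 m) (Prod.snd : ℝ × N → N) (s, n)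
        (![((σ, w) : ℝ × EuclideanSpace ℝ (Fin m))] i)) = ![w] := by
      funext i
      fin_cases i
      show mfderiv (𝓘(ℝ, ℝ).prod (𝓡 m)) (𝓡 m) (Prod.snd : ℝ × N → N) (s, n)
        ((σ, w) : ℝ × EuclideanSpace ℝ (Fin m)) = w
      rw [mfderiv_snd]
      rfl
    show γ₁ (s, n) ![((σ, w) : ℝ × EuclideanSpace ℝ (Fin m))] +
      γ₂ (s, n) ![((σ, w) : ℝ × EuclideanSpace ℝ (Fin m))] = σ + α n ![w]
    rw [hγ₁, hγ₂, MForm.pullback_apply, MForm.pullback_apply]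
    exact (congrArg₂ (fun u v => τ s u + α n v) h1 h2).trans rfl
  have hβγ : β = γ₁ + γ₂ := by
    funext p
    obtain ⟨s, n⟩ := p
    refine ContinuousAlternatingMap.ext fun v => ?_
    have hv : v = ![(((v 0 : ℝ × EuclideanSpace ℝ (Fin m)).1,
        (v 0 : ℝ × EuclideanSpace ℝ (Fin m)).2) : ℝ × EuclideanSpace ℝ (Fin m))] := by
      funext i
      fin_cases i
      rfl
    rw [hv]
    exact (pullback_expSmul_apply hθ hinv hX s n _ _).trans (hγval s n _ _).symm
  -- smoothness of the three pull-backs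
  have hΦs : ∀ q : ℝ × N, ∀ᶠ z in 𝓝 q, ContMDiffAt (𝓘(ℝ, ℝ).prod (𝓡 m)) (𝓡 m) ∞ Φ z :=
    fun q => Eventually.of_forall fun z => (contMDiff_expSmul hθ).contMDiffAt
  have hfst : ∀ q : ℝ × N, ∀ᶠ z in 𝓝 q,
      ContMDiffAt (𝓘(ℝ, ℝ).prod (𝓡 m)) 𝓘(ℝ, ℝ) ∞ (Prod.fst : ℝ × N → ℝ) z :=
    fun q => Eventually.of_forall fun z => contMDiffAt_fst
  have hsnd : ∀ q : ℝ × N, ∀ᶠ z in 𝓝 q,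
      ContMDiffAt (𝓘(ℝ, ℝ).prod (𝓡 m)) (𝓡 m) ∞ (Prod.snd : ℝ × N → N) z :=
    fun q => Eventually.of_forall fun z => contMDiffAt_snd
  have hγ1 : IsSmoothForm γ₁ :=
    (isSmoothForm_iff_smoothAt _).2 fun q => MForm.SmoothAt.pullback (hfst q) (hτs _)
  have hγ2 : IsSmoothForm γ₂ :=
    (isSmoothForm_iff_smoothAt _).2 fun q => MForm.SmoothAt.pullback (hsnd q) (hαs _)
  -- differentiate both at `(0, n)`
  have hdβ : mextDeriv β (0, n) = (mextDeriv α).pullback (𝓘(ℝ, ℝ).prod (𝓡 m)) Φ (0, n) :=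
    mextDeriv_pullback_apply (hΦs _) (hαs _)
  -- every real `2`-form on the real line vanishes (`Subsingleton.eq_zero`)
  have hdτ : mextDeriv τ = 0 := funext fun s =>
    Subsingleton.eq_zero (α := ℝ [⋀^Fin 2]→L[ℝ] ℝ) (mextDeriv τ s)
  have hdγ : mextDeriv (γ₁ + γ₂) (0, n) =
      (mextDeriv α).pullback (𝓘(ℝ, ℝ).prod (𝓡 m)) (Prod.snd : ℝ × N → N) (0, n) := by
    rw [mextDeriv_add hγ1 hγ2]
    show mextDeriv γ₁ (0, n) + mextDeriv γ₂ (0, n) = _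
    rw [hγ₁, hγ₂, mextDeriv_pullback_apply (hfst _) (hτs _),
      mextDeriv_pullback_apply (hsnd _) (hαs _), hdτ, MForm.pullback_zero]
    simp
  have key := congrArg (fun (η : MForm (𝓘(ℝ, ℝ).prod (𝓡 m)) (ℝ × N) ℝ 2) => η (0, n)
    ![(((1 : ℝ), (0 : EuclideanSpace ℝ (Fin m))) : ℝ × EuclideanSpace ℝ (Fin m)),
      (((0 : ℝ), (w : EuclideanSpace ℝ (Fin m))) : ℝ × EuclideanSpace ℝ (Fin m))])
    (show mextDeriv β = mextDeriv (γ₁ + γ₂) by rw [hβγ])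
  beta_reduce at key
  rw [hdβ, hdγ, MForm.pullback_apply, MForm.pullback_apply] at key
  -- the right-hand side vanishes: the first vector projects to `0`
  have hR : (mextDeriv α) ((Prod.snd : ℝ × N → N) (0, n))
      (fun i => mfderiv (𝓘(ℝ, ℝ).prod (𝓡 m)) (𝓡 m) (Prod.snd : ℝ × N → N) (0, n)
        (![(((1 : ℝ), (0 : EuclideanSpace ℝ (Fin m))) : ℝ × EuclideanSpace ℝ (Fin m)),
          (((0 : ℝ), (w : EuclideanSpace ℝ (Fin m))) : ℝ × EuclideanSpace ℝ (Fin m))] i)) = 0 := by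
    refine (mextDeriv α _).map_coord_zero 0 ?_
    show mfderiv (𝓘(ℝ, ℝ).prod (𝓡 m)) (𝓡 m) (Prod.snd : ℝ × N → N) (0, n)
      (((1 : ℝ), (0 : EuclideanSpace ℝ (Fin m))) : ℝ × EuclideanSpace ℝ (Fin m)) = 0
    rw [mfderiv_snd]
    rfl
  have key2 := key.trans hR
  -- the left-hand side is `dα_{Φ(0,n)}(X, w)`
  have hL : (fun i => mfderiv (𝓘(ℝ, ℝ).prod (𝓡 m)) (𝓡 m) Φ (0, n)
      (![(((1 : ℝ), (0 : EuclideanSpace ℝ (Fin m))) : ℝ × EuclideanSpace ℝ (Fin m)),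
        (((0 : ℝ), (w : EuclideanSpace ℝ (Fin m))) : ℝ × EuclideanSpace ℝ (Fin m))] i)) =
      ![(circleFundVec (Circle.exp 0 • n) : EuclideanSpace ℝ (Fin m)),
        (mfderiv (𝓡 m) (𝓡 m) (fun x : N => Circle.exp 0 • x) n w : EuclideanSpace ℝ (Fin m))] := by
    funext i
    fin_cases i
    · exact mfderiv_expSmul_inl hθ 0 n
    · exact (mfderiv_smul_eq_mfderiv_expSmul hθ 0 n w).symm
  have key3 : mextDeriv α (Φ (0, n))
      ![(circleFundVec (Circle.exp 0 • n) : EuclideanSpace ℝ (Fin m)),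
        (mfderiv (𝓡 m) (𝓡 m) (fun x : N => Circle.exp 0 • x) n w : EuclideanSpace ℝ (Fin m))] = 0 :=
    (congrArg (mextDeriv α (Φ (0, n))) hL).symm.trans key2
  have hid : (fun x : N => Circle.exp 0 • x) = id := by
    funext x
    rw [Circle.exp_zero, one_smul, id]
  rw [hid, mfderiv_id] at key3
  -- transport from the point `Φ (0, n) = e^{i0} • n` to `n`
  have h0 : Circle.exp 0 • n = n := by rw [Circle.exp_zero, one_smul]
  have gen : ∀ (z : N) (_ : z = n),
      mextDeriv α z
          ![(circleFundVec z : EuclideanSpace ℝ (Fin m)), (w : EuclideanSpace ℝ (Fin m))] = 0 →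
        mextDeriv α n ![circleFundVec n, w] = 0 := by
    intro z hz h
    subst hz
    exact h
  exact gen _ h0 key3

/-- **Existence of a connection form for a free smooth circle action** (Cannas da Silva–
Guillemin–Woodward 2000, proof of Thm. 1: "`α` an `S¹`-connection form"; Kobayashi–Nomizu I,
Ch. II, Thm. 2.1): on a Hausdorff `σ`-compact manifold `N` with a free smooth circle action there
is a smooth `1`-form `α` which is invariant, `(a • ·)^* α = α` for all `a ∈ S¹`, normalised on
the fundamental vector field, `α(X) ≡ 1`, and (consequently) has horizontal curvature,
`dα(X, ·) = 0`.  It is the circle average of any smooth `1`-form `α₀` with `α₀(X) ≡ 1`.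
[cite: CannasGuilleminWoodward2000, proof of Thm. 1] -/
theorem exists_circleConnectionForm [T2Space N] [SigmaCompactSpace N]
    (hθ : ContMDiff ((𝓡 1).prod (𝓡 m)) (𝓡 m) ∞ (fun x : Circle × N => x.1 • x.2))
    (hfree : ∀ (a : Circle) (n : N), a • n = n → a = 1) :
    ∃ α : MForm (𝓡 m) N ℝ 1, IsSmoothForm α ∧
      (∀ (a : Circle) (n : N) (v : Fin 1 → TangentSpace (𝓡 m) n),
        α (a • n) (fun i => mfderiv (𝓡 m) (𝓡 m) (fun x : N => a • x) n (v i)) = α n v) ∧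
      (∀ n : N, α n ![circleFundVec n] = 1) ∧
      ∀ (n : N) (w : TangentSpace (𝓡 m) n), mextDeriv α n ![circleFundVec n, w] = 0 := by
  obtain ⟨α₀, hα₀, hα₀X⟩ :=
    exists_isSmoothForm_apply_eq_one (contMDiff_circleFundVec hθ) (circleFundVec_ne_zero hθ hfree)
  obtain ⟨α, hα, hinv, hval⟩ := exists_circleAverage_oneForm hθ hα₀
  have hX : ∀ n : N, α n ![circleFundVec n] = 1 := fun n =>
    circleAverage_apply_orbitVelocity hθ hval hα₀X n
  exact ⟨α, hα, hinv, hX, fun n w => mextDeriv_apply_circleFundVec hθ hα hinv hX n w⟩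


end Literature.Geometry.Symplectic

end
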